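import Summits.HubbardSuperconductivity.HubbardSuperconductivity.Theorems.NodalWardXYNodalPropagatorDecayXDecay

/-!
# Nodal propagator decay (route `NodalWardXY`, item `NodalPropagatorDecay`): VI. the theorem

`nodalPropagatorDecay_proof : NodalPropagatorDecay`.  The four bounds — trivial `4π²`,
`τ`-decay `C/τ²` (file IV), `x`-decay `C/m₀²` (file V) and its mirror image `C/m₁²` under the
swap `p₁ ↔ p₂` (which exchanges `m₀ ↔ m₁` and only flips the sign of the `Δ/E` weight) — are
combined through `(1 + a + b + c)² ≤ 4(1 + a² + b² + c²)`.

Sources: the item docstring (Theses/NodalWardXY.lean); nearest printed analogue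
Giuliani–Mastropietro, CMP 293 (2010) (honeycomb Dirac propagator bounds).  No definitions.
-/

noncomputable section

namespace Summit.HubbardSuperconductivity.HubbardSuperconductivity.Theorems

namespace NodalDecay

open Real MeasureTheory intervalIntegral

/-! ### The integrand of the item (local notation) -/

local notation "ξ⟪" μ ", " p "⟫" => -2 * (Real.cos (Prod.fst p) + Real.cos (Prod.snd p)) - μ
local notation "Δ⟪" Δ₀ ", " p "⟫" => 2 * Δ₀ * (Real.cos (Prod.fst p) - Real.cos (Prod.snd p))
local notation "E⟪" μ ", " Δ₀ ", " p "⟫" => Real.sqrt (ξ⟪μ, p⟫ ^ 2 + Δ⟪Δ₀, p⟫ ^ 2)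
local notation "W⟪" μ ", " Δ₀ ", " j ", " p "⟫" =>
  (![(1:ℝ), ξ⟪μ, p⟫ / E⟪μ, Δ₀, p⟫, Δ⟪Δ₀, p⟫ / E⟪μ, Δ₀, p⟫] : Fin 3 → ℝ) j
local notation "Φ⟪" μ ", " Δ₀ ", " m₀ ", " m₁ ", " τ ", " j ", " p "⟫" =>
  Complex.exp (Complex.I * (((Prod.fst p) * ((m₀ : ℤ) : ℝ) + (Prod.snd p) * ((m₁ : ℤ) : ℝ) : ℝ) : ℂ))
    * ((Real.exp (-|τ| * E⟪μ, Δ₀, p⟫) : ℝ) : ℂ) * ((W⟪μ, Δ₀, j, p⟫ : ℝ) : ℂ)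
set_option quotPrecheck false in
local notation "box" => Set.Icc (-Real.pi) Real.pi ×ˢ Set.Icc (-Real.pi) Real.pi


/-! ### The swap symmetry `p₁ ↔ p₂` -/

/-- Swapping the two momenta exchanges `m₀ ↔ m₁` (the `Δ/E` weight only flips sign), so the norm
of the integral is symmetric in `(m₀, m₁)`. -/
theorem norm_integral_swap (μ Δ₀ : ℝ) (m₀ m₁ : ℤ) (τ : ℝ) (j : Fin 3) :
    ‖∫ p in box, Φ⟪μ, Δ₀, m₀, m₁, τ, j, p⟫‖ = ‖∫ p in box, Φ⟪μ, Δ₀, m₁, m₀, τ, j, p⟫‖ := by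
  have h := setIntegral_prod_swap (Set.Icc (-π) π) (Set.Icc (-π) π)
    (fun p : ℝ × ℝ => Φ⟪μ, Δ₀, m₀, m₁, τ, j, p⟫) (μ := MeasureTheory.volume) (ν := MeasureTheory.volume)
  rw [← Measure.volume_eq_prod] at h
  rw [← h]
  have hbox : MeasurableSet (box) := measurableSet_Icc.prod measurableSet_Icc
  rcases weight_cases j with hw | hw | hw <;> simp_rw [hw]
  · congr 1
    refine setIntegral_congr_fun hbox (fun z _ => ?_)
    simp only [Prod.fst_swap, Prod.snd_swap]
    ring_nf
  · congr 1
    refine setIntegral_congr_fun hbox (fun z _ => ?_)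
    simp only [Prod.fst_swap, Prod.snd_swap]
    ring_nf
  · rw [← norm_neg, ← MeasureTheory.integral_neg]
    congr 1
    refine setIntegral_congr_fun hbox (fun z _ => ?_)
    simp only [Prod.fst_swap, Prod.snd_swap]
    push_cast
    ring_nf

/-! ### The theorem -/

/-- `(1 + a + b + c)² ≤ 4 (1 + a² + b² + c²)`. -/
theorem sq_sum_four_le (a b c : ℝ) : (1 + a + b + c) ^ 2 ≤ 4 * (1 + a ^ 2 + b ^ 2 + c ^ 2) := by
  nlinarith [sq_nonneg (1 - a), sq_nonneg (1 - b), sq_nonneg (1 - c), sq_nonneg (a - b),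
    sq_nonneg (a - c), sq_nonneg (b - c)]

/-- **Nodal propagator decay** (item `stmt-HubbardSuperconductivity-1269`, route `NodalWardXY`):
the three Nambu components of the lattice d-wave BdG propagator decay like
`C(μ, Δ₀) (1 + |x₁| + |x₂| + |τ|)⁻²`.  Assembled from the trivial bound `4π²`, the `τ`-decay
`C/τ²` (conical lower bound on `E`) and the `x`-decay `C/xᵢ²` (one and three integrations by parts
along momentum lines, where the integrand is a universal one-variable profile of `a cos p + b`). -/
theorem _root_.Summit.HubbardSuperconductivity.HubbardSuperconductivity.Theorems.nodalPropagatorDecay_proof :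
    Summit.HubbardSuperconductivity.HubbardSuperconductivity.Theses.NodalWardXY.NodalPropagatorDecay := by
  intro μ hμ _hμ0 Δ₀ hΔ
  show ∃ C : ℝ, ∀ (x : Fin 2 → ℤ) (τ : ℝ) (j : Fin 3),
    ‖∫ p in box, Φ⟪μ, Δ₀, x 0, x 1, τ, j, p⟫‖ ≤ C / (1 + |(x 0 : ℝ)| + |(x 1 : ℝ)| + |τ|) ^ 2
  obtain ⟨Cτ, hCτ⟩ := norm_integral_le_tau hμ hΔ
  obtain ⟨Cx, hCx⟩ := norm_integral_le_x0 hμ hΔ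
  refine ⟨4 * (4 * π ^ 2 + |Cx| + |Cx| + |Cτ|), fun x τ j => ?_⟩
  set n := ‖∫ p in box, Φ⟪μ, Δ₀, x 0, x 1, τ, j, p⟫‖ with hn
  have hn0 : 0 ≤ n := norm_nonneg _
  have h0 : n ≤ 4 * π ^ 2 := norm_integral_le_const μ Δ₀ (x 0) (x 1) τ j
  have hτ : n * |τ| ^ 2 ≤ |Cτ| := by
    rcases eq_or_ne τ 0 with h | h
    · rw [h]; simp
    · have := hCτ (x 0) (x 1) τ j h
      rw [le_div_iff₀ (by positivity)] at this
      rw [sq_abs]; exact this.trans (le_abs_self _)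
  have hx0 : n * |(x 0 : ℝ)| ^ 2 ≤ |Cx| := by
    rcases eq_or_ne (x 0) 0 with h | h
    · rw [h]; simp
    · have := hCx (x 0) (x 1) τ j h
      rw [le_div_iff₀ (by positivity)] at this
      rw [sq_abs]; exact this.trans (le_abs_self _)
  have hx1 : n * |(x 1 : ℝ)| ^ 2 ≤ |Cx| := by
    rcases eq_or_ne (x 1) 0 with h | h
    · rw [h]; simp
    · have := hCx (x 1) (x 0) τ j h
      rw [← norm_integral_swap, le_div_iff₀ (by positivity)] at this
      rw [sq_abs]; exact this.trans (le_abs_self _)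
  have hpos : 0 < (1 + |(x 0 : ℝ)| + |(x 1 : ℝ)| + |τ|) ^ 2 := by positivity
  rw [le_div_iff₀ hpos]
  calc n * (1 + |(x 0 : ℝ)| + |(x 1 : ℝ)| + |τ|) ^ 2
      ≤ n * (4 * (1 + |(x 0 : ℝ)| ^ 2 + |(x 1 : ℝ)| ^ 2 + |τ| ^ 2)) :=
        mul_le_mul_of_nonneg_left (sq_sum_four_le _ _ _) hn0
    _ = 4 * (n + n * |(x 0 : ℝ)| ^ 2 + n * |(x 1 : ℝ)| ^ 2 + n * |τ| ^ 2) := by ring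
    _ ≤ 4 * (4 * π ^ 2 + |Cx| + |Cx| + |Cτ|) := by gcongr

end NodalDecay

end Summit.HubbardSuperconductivity.HubbardSuperconductivity.Theorems
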